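import Literature.MathematicalPhysics.QuantumFieldTheory.Balaban1983to89.B5SectBStatements

/-!
# `Balaban1983to89.B5HierGaugeTorus` — T. Bałaban, *Propagators and renormalization transformations for lattice gauge
theories. I*, Commun. Math. Phys. **95** (1984) 17–40 [Balaban1984PropagatorsI], pp. 19–21 [PDF 3–5]: the HIERARCHICAL
BLOCK-AXIAL GAUGE behind (1.17) ⟹ (1.23) — for every field `A` on level `k` of the tower there is EXACTLY ONE restricted gauge
function `λ ∈ N(Q′_k)` putting `A^λ, QA^λ, …, Q_{k−1}A^λ` in the block axial gauge — PROVED for the typed objects of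
`B5SectBStatements` (the tower of tori `towerM`, `Qk`, `Qsk`, `AxAll`, `gaugeR`)

statement-level skeleton of published theorems with citation tags; proofs where landed; nothing here is a claim about the Yang–Mills mass gap

PDF held: `paper:balaban1984-cmp95-propagators-rt-i` ((1.4) p. 18, (1.7)/(1.10)/(1.12)/(1.15) p. 19, (1.16)–(1.20) p. 20, (1.23)
p. 21 = PDF pp. 2–5, read as images on the page renders `run/shared/lean/pub/pub-balaban/b2b-balaban-ref1/pages/
1984-cmp95-propagators-rt-I/…-p003-x2.png … -p005-x2.png`).

WHAT IS REPRODUCED.  SKELETON row `B5.Eq1.23`, MIDDLE TERM of (1.23), Phase-2 seat p37 (gen 2): in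
  «(1.17) = z^{(k)}∫dA δ(B − Q_kA)(∫dλ′ δ(Q′_kλ′)·δ_Ax(Q_{k−1}A + ∂^{L^{−1}}Q′_{k−1}λ′)·…·δ_Ax(A + ∂^ηλ′))·… = z′^{(k)}∫dA δ(B − Q_kA)…»
the λ′-integral of the axial δ-functions is an `A`-independent constant because (p. 20: «The δ-function δ(B − Q_kA) is
invariant with respect to gauge transformations λ satisfying the condition Q′_kλ = 0 and we can look at the integral (1.17) as
obtained by removing this gauge freedom by the help of the δ-functions δ_Ax») the block axial conditions are a COMPLETE and
UNAMBIGUOUS gauge fixing of `N(Q′_k)`.  The tree states this abstractly (`B5.HierGauge.complete/unique`, GAPS G-B5-01R);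
the B5 owner's typed statement `B5SectBStatements.Eq123` lives on the concrete tower; THIS FILE proves the lemma THERE:
* `hierGauge_exists` / `hierGauge_unique` / `hierGauge_existsUnique` — `∀ k A, ∃! λ, Qsk L M k λ = 0 ∧ gaugeR L M k A λ ∈ AxAll L M k`;
* on the way, AS PRINTED: §2 «A(Γ_{y,x})» of a pure gauge telescopes along the staircase contour (1.7), `(∂^cλ)(Γ_{y,x}) =
  c(λ(x) − λ(y))` (`axSum_Dgrad`), so `∂^cλ` is axial iff `λ` is block constant (`Dgrad_mem_Ax_iff`, (1.10)); §3 one level: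
  `λ ∈ N(Q′)` with `∂λ` axial is `0`, and every `A` has `λ ∈ N(Q′)` with `A + ∂λ` axial (`λ₀(x) = −c⁻¹A(Γ_{y,x})`, then
  subtract the block-constant `Q′λ₀`, (1.15)); §4 the same with a PRESCRIBED average `Q′λ = μ` (block lifts) and (1.20) on
  real fields `Q(∂^{n}λ) = ∂^{1}(Q′λ)` (`Qlin_Dgrad`, from the tree's `B5Block118.QvOp_gaugeT_eq` through r02's dictionaries
  `cplx_Qlin`, `cplxS_QsLin`); §5 on the tower: «Q(A^λ) = (QA)^{Q′λ}» between levels (`Qlin_gaugeR_succ`), «Q_k∂^{L^k} =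
  ∂^{1}Q′_k» (`Qk_Dg`, hence `Q_k∂λ = 0` on `N(Q′_k)`: the invariance of `δ(B − Q_kA)` quoted above), `S^η(A^λ) = S^η(A)`
  (`actionEta_gaugeR` = `B5Action121.actionS_gaugeT`), and the induction on `k`.

TYPING: real fields `Fld N = EuclideanSpace ℝ (Tor N × Fin d)`, `Scl N`, the maps `Qlin`, `QsLin`, `axSum`/`Ax`, the tower
`towerM L M k`, `Qk`, `Qsk`, `AxAll`, `gaugeR` exactly as in `B5SectBStatements`; the gradient `Dgrad N c` ((1.4) with
lattice factor `c`) is the one new definition (`gaugeR L M k A λ = A − Dgrad (towerM L M k) (L^k) λ`, `gaugeR_eq_sub_Dgrad`).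

NOT CERTIFIED HERE: the V1-calculus twin (`B5HierAxialGaugeV1`, same seat) and any bridge between the carriers; the use of
the lemma in (1.22)/(1.23) is the companion `B5Eq123Torus`.  Helper facts carry the cite of the display they serve.

Unit `lit-balaban-p37` gen 2 (Phase-2 proof seat p37; literature-prover-lit-balaban-p37-g2-0), HOME
`run/shared/lean/pub/lit-balaban/` (STATUS: `lit-balaban-p37/STATUS.md`), 2026-08-21.
-/

namespace Literature.MathematicalPhysics.QuantumFieldTheory.Balaban1983to89.B5HierGaugeTorus

open B5SectBStatements
open B5Prop11Plancherel (Tor fine unitVec)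
open B5Block118 (bpt tstep up iota)
open Beta.FluctuationProjection (digitOf digitOf_bpt bpt_blockOf_digitOf bpt_add_tstep_of_lt)
open scoped Matrix

noncomputable section

variable {d : ℕ}

/-! ## §1  The gradient `∂^c` on REAL scalar functions of a torus and the printed gauge action `A^λ = A − ∂^cλ` -/

section Gradient

variable (N : Fin d → ℕ)

/-- `(∂^cλ)_ν(x) = c·(λ(x + e_ν) − λ(x))`, the gradient (1.4) with lattice factor `c` (`c = η⁻¹ = L^k` on `T_η`), as a
real-linear map from scalar functions to vector fields. [cite: Balaban1984PropagatorsI, (1.4) p.18] -/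
def Dgrad (c : ℝ) : Scl N →ₗ[ℝ] Fld N where
  toFun l := WithLp.toLp 2 fun i => c * (l (i.1 + unitVec N i.2) - l i.1)
  map_add' l l' := by
    ext i
    simp only [PiLp.add_apply]
    ring
  map_smul' a l := by
    ext i
    simp only [PiLp.smul_apply, smul_eq_mul, RingHom.id_apply]
    ring

/-- components of `∂^cλ`. [cite: Balaban1984PropagatorsI, (1.4) p.18] -/
theorem Dgrad_apply (c : ℝ) (l : Scl N) (i : Tor N × Fin d) :
    Dgrad N c l i = c * (l (i.1 + unitVec N i.2) - l i.1) := rfl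

end Gradient

section GaugeDict

variable (L : ℕ) (M : Fin d → ℕ) [NeZero L] [hM : ∀ μ, NeZero (M μ)]

omit [NeZero L] hM in
/-- DICTIONARY: the typed gauge transformation `gaugeR` of `B5SectBStatements` ((1.20), level `k` of the tower, factor
`L^k`) is `A ↦ A − ∂^{L^k}λ`. [cite: Balaban1984PropagatorsI, (1.20) p.20] -/
theorem gaugeR_eq_sub_Dgrad (k : ℕ) (A : Fld (towerM L M k)) (l : Scl (towerM L M k)) :
    gaugeR L M k A l = A - Dgrad (towerM L M k) ((L : ℝ) ^ k) l := by
  ext i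
  simp only [gaugeR, PiLp.toLp_apply, PiLp.sub_apply, Dgrad_apply]

end GaugeDict

/-! ## §2  «A(Γ_{y,x})» of a pure gauge telescopes: `(∂^cλ)(Γ_{y,x}) = c·(λ(x) − λ(y))` on the torus carrier -/

section Telescope

variable (n : ℕ) [NeZero n] (M : Fin d → ℕ) [hM : ∀ μ, NeZero (M μ)]

/-- the partial digit vector «coordinates `≥ m` already at `x`, the others still at `y`»: the corner of the staircase
(1.7) reached after the coordinates `d−1, …, m` have been moved. [cite: Balaban1984PropagatorsI, (1.7) p.18] -/
private def corner (j : Fin d → Fin n) (m : ℕ) : Fin d → Fin n :=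
  fun μ => if m ≤ (μ : ℕ) then j μ else 0

/-- before any move the corner is `x` itself. [cite: Balaban1984PropagatorsI, (1.7) p.18] -/
private theorem corner_zero (j : Fin d → Fin n) : corner n j 0 = j := by
  funext μ; simp [corner]

/-- after all `d` moves (read backwards: before the first) the corner is the base point `y`. [cite: Balaban1984PropagatorsI, (1.7) p.18] -/
private theorem corner_d (j : Fin d → Fin n) : corner n j d = fun _ => 0 := by
  funext μ; simp [corner, Nat.not_le.mpr μ.isLt]

/-- the end point of the run in direction `ν`: `stairPt j ν (j ν)` is the corner with the coordinates `≥ ν` moved. [folklore] -/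
private theorem stairPt_top (j : Fin d → Fin n) (ν : Fin d) : stairPt n j ν (j ν) = corner n j ν := by
  funext μ
  simp only [stairPt, corner]
  by_cases h1 : ν < μ
  · rw [if_pos h1, if_pos (le_of_lt (Fin.lt_def.mp h1))]
  · rw [if_neg h1]
    by_cases h2 : μ = ν
    · subst h2; simp
    · have : ¬ ((ν : ℕ) ≤ (μ : ℕ)) := by
        intro h; rcases lt_or_eq_of_le h with h' | h'
        · exact h1 (Fin.lt_def.mpr h')
        · exact h2 (Fin.ext h'.symm)
      rw [if_neg h2, if_neg this]

/-- the starting point of the run in direction `ν`: `stairPt j ν 0` is the corner with the coordinates `> ν` moved. [folklore] -/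
private theorem stairPt_bot (j : Fin d → Fin n) (ν : Fin d) : stairPt n j ν 0 = corner n j (ν + 1) := by
  funext μ
  simp only [stairPt, corner]
  by_cases h1 : ν < μ
  · rw [if_pos h1, if_pos (Nat.succ_le_of_lt (Fin.lt_def.mp h1))]
  · rw [if_neg h1]
    have : ¬ ((ν : ℕ) + 1 ≤ (μ : ℕ)) := fun h => h1 (Fin.lt_def.mpr (Nat.lt_of_succ_le h))
    rw [if_neg this]
    by_cases h2 : μ = ν
    · rw [if_pos h2]
    · rw [if_neg h2]

omit hM in
/-- one step of the run in direction `ν` inside the block: consecutive staircase points are nearest neighbours. [folklore] -/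
private theorem bpt_stairPt_succ (y : Tor M) (j : Fin d → Fin n) (ν : Fin d) (t : ℕ) (ht : t + 1 < n) :
    bpt n M y (stairPt n j ν ⟨t, by omega⟩) + unitVec (fine n M) ν = bpt n M y (stairPt n j ν ⟨t + 1, ht⟩) := by
  have h1 : unitVec (fine n M) ν = tstep (fine n M) ν 1 := by
    rw [show (1 : ℕ) = 0 + 1 from rfl, B5Block118.tstep_succ, B5Block118.tstep_zero, zero_add]
  have hlt : ((stairPt n j ν ⟨t, by omega⟩ ν : Fin n) : ℕ) + 1 < n := by
    simp only [stairPt, lt_irrefl, if_false, if_true]; exact ht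
  rw [h1, bpt_add_tstep_of_lt n M y _ ν 1 hlt]
  congr 1
  funext μ
  by_cases hμ : μ = ν
  · subst hμ; simp [stairPt]
  · simp [stairPt, hμ]

omit hM in
/-- **`(∂^cλ)(Γ_{y,x}) = c·(λ(x) − λ(y))`** for `x = ny + j ∈ B(y)` (base point `y ↦ ny`): the contour sum (1.7) of a pure
gauge telescopes along the staircase. [cite: Balaban1984PropagatorsI, (1.9) p.19] -/
theorem axSum_Dgrad (c : ℝ) (l : Scl (fine n M)) (y : Tor M) (j : Fin d → Fin n) :
    axSum n M (WithLp.ofLp (Dgrad (fine n M) c l)) y j = c * (l (bpt n M y j) - l (bpt n M y (fun _ => 0))) := by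
  -- the run in direction `ν` telescopes to `c·(λ(corner ν) − λ(corner (ν+1)))`
  have hrun : ∀ ν : Fin d,
      ∑ t : Fin n, (if (t : ℕ) < (j ν : ℕ) then (1 : ℝ) else 0) * Dgrad (fine n M) c l (bpt n M y (stairPt n j ν t), ν)
        = c * (l (bpt n M y (corner n j ν)) - l (bpt n M y (corner n j (ν + 1)))) := by
    intro ν
    -- write the sum over `Fin n` as a sum over `range n` of a function of `ℕ`
    set g : ℕ → ℝ := fun t => if h : t < n then l (bpt n M y (stairPt n j ν ⟨t, h⟩)) else 0 with hg
    have hterm : ∀ t : Fin n, (if (t : ℕ) < (j ν : ℕ) then (1 : ℝ) else 0) *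
        Dgrad (fine n M) c l (bpt n M y (stairPt n j ν t), ν)
          = if (t : ℕ) < (j ν : ℕ) then c * (g (t + 1) - g t) else 0 := by
      intro t
      by_cases ht : (t : ℕ) < (j ν : ℕ)
      · have ht1 : (t : ℕ) + 1 < n := lt_of_le_of_lt (Nat.succ_le_of_lt ht) (j ν).isLt
        rw [if_pos ht, if_pos ht, one_mul, Dgrad_apply]
        have e1 : g ((t : ℕ) + 1) = l (bpt n M y (stairPt n j ν ⟨(t : ℕ) + 1, ht1⟩)) := by
          simp only [hg, dif_pos ht1]
        have e0 : g (t : ℕ) = l (bpt n M y (stairPt n j ν t)) := by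
          simp only [hg, dif_pos t.isLt, Fin.eta]
        rw [e1, e0, ← bpt_stairPt_succ n M y j ν t ht1]
      · rw [if_neg ht, if_neg ht, zero_mul]
    simp_rw [hterm]
    rw [Fin.sum_univ_eq_sum_range (fun t => if t < (j ν : ℕ) then c * (g (t + 1) - g t) else 0) n]
    rw [← Finset.sum_filter, show (Finset.range n).filter (fun t => t < (j ν : ℕ)) = Finset.range (j ν) from by
      ext t; simp only [Finset.mem_filter, Finset.mem_range]; constructor
      · exact fun h => h.2
      · exact fun h => ⟨lt_trans h (j ν).isLt, h⟩]
    rw [← Finset.mul_sum, Finset.sum_range_sub]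
    have eTop : g (j ν : ℕ) = l (bpt n M y (corner n j ν)) := by
      simp only [hg, dif_pos (j ν).isLt, Fin.eta, stairPt_top]
    have eBot : g 0 = l (bpt n M y (corner n j (ν + 1))) := by
      simp only [hg, dif_pos (Nat.pos_of_ne_zero (NeZero.ne n))]
      rw [show (⟨0, Nat.pos_of_ne_zero (NeZero.ne n)⟩ : Fin n) = 0 from rfl, stairPt_bot]
    rw [eTop, eBot]
  unfold axSum
  simp_rw [hrun]
  rw [← Finset.mul_sum]
  congr 1
  rw [Fin.sum_univ_eq_sum_range (fun m => l (bpt n M y (corner n j m)) - l (bpt n M y (corner n j (m + 1)))) d,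
    Finset.sum_range_sub', corner_zero, corner_d]

omit hM in
/-- **The pure gauges in the axial gauge are the gradients of BLOCK-CONSTANT functions**: `∂^cλ ∈ Ax` iff
`λ(x) = λ(y)` for all `x ∈ B(y)` (`c ≠ 0`). [cite: Balaban1984PropagatorsI, (1.10) p.19] -/
theorem Dgrad_mem_Ax_iff {c : ℝ} (hc : c ≠ 0) (l : Scl (fine n M)) :
    Dgrad (fine n M) c l ∈ Ax n M ↔ ∀ (y : Tor M) (j : Fin d → Fin n), l (bpt n M y j) = l (bpt n M y (fun _ => 0)) := by
  rw [mem_Ax_iff]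
  refine forall_congr' fun y => forall_congr' fun j => ?_
  rw [axSum_Dgrad, mul_eq_zero, sub_eq_zero]
  exact ⟨fun h => h.resolve_left hc, fun h => Or.inr h⟩

end Telescope

/-! ## §3  The block-axial gauge on ONE level of the tower: for every field there is EXACTLY ONE `λ ∈ N(Q′)` with `A^λ`
axial (the induction step of §5) -/

section HierOne

variable (n : ℕ) [NeZero n] (M : Fin d → ℕ) [hM : ∀ μ, NeZero (M μ)]

omit hM in
/-- `axSum` is additive in the field (it is the linear functional `axFun`). [folklore] -/
private theorem axSum_add (A B : Fld (fine n M)) (y : Tor M) (j : Fin d → Fin n) :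
    axSum n M (WithLp.ofLp (A + B)) y j = axSum n M (WithLp.ofLp A) y j + axSum n M (WithLp.ofLp B) y j := by
  have h := map_add (axFun n M y j) A B
  simpa only [axFun_apply] using h

omit hM in
/-- `axSum` at the base point (digit vector `0`) vanishes: `Γ_{y,y}` is empty. [folklore] -/
private theorem axSum_zero_dig (A : Tor (fine n M) × Fin d → ℝ) (y : Tor M) :
    axSum n M A y (fun _ => 0) = 0 := by
  unfold axSum
  refine Finset.sum_eq_zero fun ν _ => Finset.sum_eq_zero fun t _ => ?_
  simp

omit [NeZero n] hM in
/-- `(Q′λ)(y)` of a scalar function in terms of its block values. [folklore] -/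
private theorem QsLin_apply' (l : Scl (fine n M)) (y : Tor M) :
    QsLin n M l y = 1 / (n : ℝ) ^ d * ∑ j : Fin d → Fin n, l (bpt n M y j) := rfl

omit hM in
/-- `Q′` of a BLOCK-CONSTANT function is that function («λ(x) = λ₁(y) for x ∈ B(y)», p. 19). [cite: Balaban1984PropagatorsI, (1.15) p.19] -/
private theorem QsLin_blockConst (l : Scl (fine n M)) (h : ∀ (y : Tor M) (j : Fin d → Fin n), l (bpt n M y j) = l (bpt n M y (fun _ => 0)))
    (y : Tor M) : QsLin n M l y = l (bpt n M y (fun _ => 0)) := by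
  rw [QsLin_apply', Finset.sum_congr rfl fun j _ => h y j, Finset.sum_const, Finset.card_univ, Fintype.card_fun,
    Fintype.card_fin, Fintype.card_fin, nsmul_eq_mul]
  have hn : ((n : ℝ) ^ d) ≠ 0 := pow_ne_zero _ (Nat.cast_ne_zero.mpr (NeZero.ne n))
  push_cast
  field_simp

/-- **UNIQUENESS (one level)**: `λ ∈ N(Q′)` (`Q′λ = 0`) with `∂^cλ` axial (`c ≠ 0`) is `0` — the block axial conditions leave no
residual gauge freedom in `N(Q′)`. [cite: Balaban1984PropagatorsI, (1.23) p.21] -/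
theorem eq_zero_of_QsLin_eq_zero_of_Dgrad_mem_Ax {c : ℝ} (hc : c ≠ 0) {l : Scl (fine n M)} (hQ : QsLin n M l = 0)
    (hAx : Dgrad (fine n M) c l ∈ Ax n M) : l = 0 := by
  rw [Dgrad_mem_Ax_iff n M hc] at hAx
  have hbase : ∀ y : Tor M, l (bpt n M y (fun _ => 0)) = 0 := by
    intro y
    rw [← QsLin_blockConst n M l hAx y, hQ]
    rfl
  ext x
  rw [← bpt_blockOf_digitOf n M x, hAx, hbase]
  rfl

/-- **EXISTENCE (one level)**: every field `A` admits `λ ∈ N(Q′)` with `A + ∂^cλ` in the block axial gauge («fixing the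
average … we remove [the gauge freedom] by the help of the δ-functions δ_Ax», pp. 19–20). [cite: Balaban1984PropagatorsI, (1.23) p.21] -/
theorem exists_QsLin_eq_zero_add_Dgrad_mem_Ax {c : ℝ} (hc : c ≠ 0) (A : Fld (fine n M)) :
    ∃ l : Scl (fine n M), QsLin n M l = 0 ∧ A + Dgrad (fine n M) c l ∈ Ax n M := by
  -- step 1: `λ₀(x) = −c⁻¹·A(Γ_{y,x})` kills all contour sums
  set l₀ : Scl (fine n M) :=
    WithLp.toLp 2 fun x => -(c⁻¹ * axSum n M A (B5Blocks16.blockOf n M x) (digitOf n M x)) with hl₀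
  have hl₀v : ∀ (y : Tor M) (j : Fin d → Fin n), l₀ (bpt n M y j) = -(c⁻¹ * axSum n M A y j) := by
    intro y j
    simp only [hl₀, WithLp.ofLp_toLp, B5Blocks16.blockOf_bpt, digitOf_bpt]
  have hAx₀ : A + Dgrad (fine n M) c l₀ ∈ Ax n M := by
    rw [mem_Ax_iff]
    intro y j
    rw [axSum_add, axSum_Dgrad, hl₀v, hl₀v, axSum_zero_dig]
    field_simp
    ring
  -- step 2: subtract the block-constant function `Q′λ₀` to land in `N(Q′)`
  set κ : Scl (fine n M) := WithLp.toLp 2 fun x => QsLin n M l₀ (B5Blocks16.blockOf n M x) with hκ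
  have hκv : ∀ (y : Tor M) (j : Fin d → Fin n), κ (bpt n M y j) = QsLin n M l₀ y := by
    intro y j
    simp only [hκ, WithLp.ofLp_toLp, B5Blocks16.blockOf_bpt]
  have hκconst : ∀ (y : Tor M) (j : Fin d → Fin n), κ (bpt n M y j) = κ (bpt n M y (fun _ => 0)) := by
    intro y j; rw [hκv, hκv]
  refine ⟨l₀ - κ, ?_, ?_⟩
  · ext y
    rw [map_sub, PiLp.sub_apply, QsLin_blockConst n M κ hκconst y, hκv, sub_self]
    rfl
  · rw [map_sub, ← add_sub_assoc]
    exact (Ax n M).sub_mem hAx₀ ((Dgrad_mem_Ax_iff n M hc κ).2 hκconst)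

end HierOne

/-! ## §4  One renormalization step with a PRESCRIBED block average, and (1.20) `Q(∂^{n}λ) = ∂^{1}(Q′λ)` on real fields -/

section OneStepGeneral

variable (n : ℕ) [NeZero n] (M : Fin d → ℕ) [hM : ∀ μ, NeZero (M μ)]

omit [NeZero n] hM in
/-- `∂^{ac}λ = ∂^{c}(aλ)`. [cite: Balaban1984PropagatorsI, (1.4) p.18] -/
theorem Dgrad_mul_left {N : Fin d → ℕ} (a c : ℝ) (l : Scl N) : Dgrad N (a * c) l = Dgrad N c (a • l) := by
  ext i
  simp only [Dgrad_apply, PiLp.smul_apply, smul_eq_mul]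
  ring

omit [NeZero n] hM in
/-- `∂^{−c}λ = −∂^{c}λ`. [cite: Balaban1984PropagatorsI, (1.4) p.18] -/
theorem Dgrad_neg {N : Fin d → ℕ} (c : ℝ) (l : Scl N) : Dgrad N (-c) l = -Dgrad N c l := by
  ext i
  simp only [Dgrad_apply, PiLp.neg_apply]
  ring

omit [NeZero n] hM in
/-- DICTIONARY: `∂^cλ` complexified is the tree's `GradOp`. [cite: Balaban1984PropagatorsI, (1.4) p.18] -/
theorem cplx_Dgrad {N : Fin d → ℕ} [∀ μ, NeZero (N μ)] (c : ℝ) (l : Scl N) :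
    cplx (Dgrad N c l) = B5Action121.GradOp N (c : ℂ) *ᵥ cplxS l := by
  funext i
  obtain ⟨x, ν⟩ := i
  simp only [cplx, cplxS, Dgrad_apply, B5Action121.GradOp_mulVec, B5Action121.sdiff_mulVec]
  push_cast
  ring

/-- `Q(∂^{n}λ) = ∂^{1}(Q′λ)` for complex gauge functions (the tree's `B5Block118.QvOp_gaugeT_eq` at `A = 0`).
[cite: Balaban1984PropagatorsI, (1.20) p.20] -/
theorem QvOp_GradOp (l : Tor (fine n M) → ℂ) :
    B5Block118.QvOp n M *ᵥ (B5Action121.GradOp (fine n M) (n : ℂ) *ᵥ l) =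
      B5Action121.GradOp M 1 *ᵥ (B5Block118.QsOp n M *ᵥ l) := by
  have h := B5Block118.QvOp_gaugeT_eq n M 0 l
  simp only [B5Action121.gaugeT, zero_sub, Matrix.mulVec_neg, Matrix.mulVec_zero, neg_inj] at h
  exact h

/-- **(1.20) on real fields**: `Q(∂^{n}λ) = ∂^{1}(Q′λ)` — the block average of a pure gauge is the pure gauge of the
averaged gauge function. [cite: Balaban1984PropagatorsI, (1.20) p.20] -/
theorem Qlin_Dgrad (l : Scl (fine n M)) : Qlin n M (Dgrad (fine n M) (n : ℝ) l) = Dgrad M 1 (QsLin n M l) := by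
  apply cplx_injective
  rw [cplx_Qlin, cplx_Dgrad, Complex.ofReal_natCast, QvOp_GradOp, ← cplxS_QsLin, cplx_Dgrad, Complex.ofReal_one]

/-- (1.20) on real fields, rescaled: `Q(∂^{an}λ) = ∂^{a}(Q′λ)`. [cite: Balaban1984PropagatorsI, (1.20) p.20] -/
theorem Qlin_Dgrad_mul (a : ℝ) (l : Scl (fine n M)) :
    Qlin n M (Dgrad (fine n M) (a * n) l) = Dgrad M a (QsLin n M l) := by
  rw [Dgrad_mul_left, Qlin_Dgrad, map_smul, ← Dgrad_mul_left, mul_one]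

/-- the lift of a function on the coarse torus to a BLOCK-CONSTANT function on the fine torus («λ(x) = λ₁(y) for
x ∈ B(y)», p. 19). [cite: Balaban1984PropagatorsI, (1.15) p.19] -/
def blockLift (μ : Scl M) : Scl (fine n M) := WithLp.toLp 2 fun x => μ (B5Blocks16.blockOf n M x)

/-- values of the block lift. [cite: Balaban1984PropagatorsI, (1.15) p.19] -/
theorem blockLift_bpt (μ : Scl M) (y : Tor M) (j : Fin d → Fin n) : blockLift n M μ (bpt n M y j) = μ y := by
  simp only [blockLift, WithLp.ofLp_toLp, B5Blocks16.blockOf_bpt]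

/-- `Q′` of the block lift of `μ` is `μ`. [cite: Balaban1984PropagatorsI, (1.15) p.19] -/
theorem QsLin_blockLift (μ : Scl M) : QsLin n M (blockLift n M μ) = μ := by
  ext y
  rw [QsLin_blockConst n M _ (fun y j => by rw [blockLift_bpt, blockLift_bpt]) y, blockLift_bpt]

/-- the pure gauge of a block lift is axial. [cite: Balaban1984PropagatorsI, (1.10) p.19] -/
theorem Dgrad_blockLift_mem_Ax (c : ℝ) (μ : Scl M) : Dgrad (fine n M) c (blockLift n M μ) ∈ Ax n M := by
  rw [mem_Ax_iff]
  intro y j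
  rw [axSum_Dgrad, blockLift_bpt, blockLift_bpt, sub_self, mul_zero]

/-- **one gauge-fixing step with a PRESCRIBED block average**: for every field `A` and every coarse gauge function `μ`
there is `λ` with `Q′λ = μ` and `A − ∂^cλ` axial (`c ≠ 0`). [cite: Balaban1984PropagatorsI, (1.23) p.21] -/
theorem exists_QsLin_eq_sub_Dgrad_mem_Ax {c : ℝ} (hc : c ≠ 0) (A : Fld (fine n M)) (μ : Scl M) :
    ∃ l : Scl (fine n M), QsLin n M l = μ ∧ A - Dgrad (fine n M) c l ∈ Ax n M := by
  obtain ⟨l₀, h0, hAx⟩ := exists_QsLin_eq_zero_add_Dgrad_mem_Ax n M (neg_ne_zero.mpr hc) A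
  refine ⟨l₀ + blockLift n M μ, by rw [map_add, h0, QsLin_blockLift, zero_add], ?_⟩
  have h1 : A - Dgrad (fine n M) c l₀ = A + Dgrad (fine n M) (-c) l₀ := by
    rw [Dgrad_neg, ← sub_eq_add_neg]
  rw [map_add, sub_add_eq_sub_sub, h1]
  exact (Ax n M).sub_mem hAx (Dgrad_blockLift_mem_Ax n M c μ)

/-- uniqueness of the step: `Q′λ = Q′λ′` and `∂^c(λ − λ′)` axial force `λ = λ′`. [cite: Balaban1984PropagatorsI, (1.23) p.21] -/
theorem eq_of_QsLin_eq_of_Dgrad_sub_mem_Ax {c : ℝ} (hc : c ≠ 0) {l l' : Scl (fine n M)} (hQ : QsLin n M l = QsLin n M l')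
    (hAx : Dgrad (fine n M) c (l - l') ∈ Ax n M) : l = l' :=
  sub_eq_zero.mp (eq_zero_of_QsLin_eq_zero_of_Dgrad_mem_Ax n M hc (by rw [map_sub, hQ, sub_self]) hAx)

/-- the constant scalar function. [cite: Balaban1984PropagatorsI, Sect. C p.22] -/
def constScl (N : Fin d → ℕ) (a : ℝ) : Scl N := WithLp.toLp 2 fun _ => a

omit hM in
/-- `Q′` of a constant is that constant. [cite: Balaban1984PropagatorsI, Sect. C p.22] -/
theorem QsLin_constScl (a : ℝ) : QsLin n M (constScl (fine n M) a) = constScl M a := by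
  ext y
  rw [QsLin_blockConst n M _ (fun y j => rfl) y]
  rfl

end OneStepGeneral

/-! ## §5  The HIERARCHICAL block-axial gauge down the tower (`B5.HierGauge.complete/unique` made concrete on `towerM`):
for every field `A` on level `k` there is exactly one `λ ∈ N(Q′_k)` with `A^λ, QA^λ, …, Q_{k−1}A^λ` all axial -/

section Tower

variable (L : ℕ) (M : Fin d → ℕ) [NeZero L] [hM : ∀ μ, NeZero (M μ)]

/-- `∂^{η⁻¹}` on level `k` (`η⁻¹ = L^k`). [cite: Balaban1984PropagatorsI, (1.20) p.20] -/
def Dg (k : ℕ) : Scl (towerM L M k) →ₗ[ℝ] Fld (towerM L M k) := Dgrad (towerM L M k) ((L : ℝ) ^ k)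

omit [NeZero L] hM in
/-- `A^λ = A − ∂^{L^k}λ` on level `k`. [cite: Balaban1984PropagatorsI, (1.20) p.20] -/
theorem gaugeR_eq_sub_Dg (k : ℕ) (A : Fld (towerM L M k)) (l : Scl (towerM L M k)) :
    gaugeR L M k A l = A - Dg L M k l :=
  gaugeR_eq_sub_Dgrad L M k A l

/-- «S^η» is gauge invariant on every level of the tower (the tree's `B5Action121.actionS_gaugeT`).
[cite: Balaban1984PropagatorsI, (1.4) p.18] -/
theorem actionEta_gaugeR (k : ℕ) (A : Fld (towerM L M k)) (l : Scl (towerM L M k)) :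
    actionEta L M k (gaugeR L M k A l) = actionEta L M k A := by
  unfold actionEta
  rw [cplx_gaugeR, B5Action121.actionS_gaugeT]

/-- `L ≠ 0` in `ℝ`. [folklore] -/
private theorem hLne : (L : ℝ) ≠ 0 := Nat.cast_ne_zero.mpr (NeZero.ne L)

/-- **(1.20) between consecutive levels**: `Q(∂^{L^{k+1}}λ) = ∂^{L^k}(Q′λ)`. [cite: Balaban1984PropagatorsI, (1.20) p.20] -/
theorem Qlin_Dg_succ (k : ℕ) (l : Scl (towerM L M (k + 1))) :
    Qlin L (towerM L M k) (Dg L M (k + 1) l) = Dg L M k (QsLin L (towerM L M k) l) := by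
  unfold Dg
  rw [pow_succ]
  exact Qlin_Dgrad_mul L (towerM L M k) ((L : ℝ) ^ k) l

/-- **(1.20) between consecutive levels, on fields**: `Q(A^λ) = (QA)^{Q′λ}`. [cite: Balaban1984PropagatorsI, (1.20) p.20] -/
theorem Qlin_gaugeR_succ (k : ℕ) (A : Fld (towerM L M (k + 1))) (l : Scl (towerM L M (k + 1))) :
    Qlin L (towerM L M k) (gaugeR L M (k + 1) A l) =
      gaugeR L M k (Qlin L (towerM L M k) A) (QsLin L (towerM L M k) l) := by
  rw [gaugeR_eq_sub_Dg, gaugeR_eq_sub_Dg]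
  refine ((Qlin L (towerM L M k)).map_sub A (Dg L M (k + 1) l)).trans ?_
  rw [Qlin_Dg_succ]

/-- **(1.20) ITERATED**: `Q_k(∂^{L^k}λ) = ∂^{1}(Q′_kλ)`. [cite: Balaban1984PropagatorsI, (1.20) p.20] -/
theorem Qk_Dg : ∀ (k : ℕ) (l : Scl (towerM L M k)), Qk L M k (Dg L M k l) = Dgrad M 1 (Qsk L M k l)
  | 0, l => by
    show Dgrad M ((L : ℝ) ^ 0) l = Dgrad M 1 l
    rw [pow_zero]
  | k + 1, l => by
    show Qk L M k (Qlin L (towerM L M k) (Dg L M (k + 1) l)) = Dgrad M 1 (Qsk L M k (QsLin L (towerM L M k) l))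
    rw [Qlin_Dg_succ]
    exact Qk_Dg k _

/-- hence `Q_k(∂^{L^k}λ) = 0` for `λ ∈ N(Q′_k)` («The δ-function δ(B − Q_kA) is invariant with respect to gauge
transformations λ satisfying the condition Q′_kλ = 0», p. 20). [cite: Balaban1984PropagatorsI, (1.20) p.20] -/
theorem Qk_Dg_eq_zero (k : ℕ) {l : Scl (towerM L M k)} (hl : Qsk L M k l = 0) : Qk L M k (Dg L M k l) = 0 := by
  rw [Qk_Dg, hl, map_zero]

omit hM in
/-- the support of the axial δ-functions one level up: `A` axial and `QA` in the support below.
[cite: Balaban1984PropagatorsI, (1.17) p.20] -/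
theorem mem_axAll_succ_iff (k : ℕ) (A : Fld (towerM L M (k + 1))) :
    A ∈ AxAll L M (k + 1) ↔ A ∈ Ax L (towerM L M k) ∧ Qlin L (towerM L M k) A ∈ AxAll L M k :=
  Iff.rfl

/-- **EXISTENCE of the hierarchical axial gauge**: for every `A` on level `k` there is `λ ∈ N(Q′_k)` with `A^λ` in the
support of `δ_Ax(Q_{k−1}·)…δ_Ax(·)` — by induction down the tower: gauge-fix `Q A` on level `k−1` by `μ`, then `A` on
level `k` with prescribed `Q′λ = μ` (§4). [cite: Balaban1984PropagatorsI, (1.23) p.21] -/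
theorem hierGauge_exists : ∀ (k : ℕ) (A : Fld (towerM L M k)),
    ∃ l : Scl (towerM L M k), Qsk L M k l = 0 ∧ gaugeR L M k A l ∈ AxAll L M k
  | 0, _ => ⟨0, map_zero _, Submodule.mem_top⟩
  | k + 1, A => by
    obtain ⟨μ, hμQ, hμAx⟩ := hierGauge_exists k (Qlin L (towerM L M k) A)
    obtain ⟨l, hlQ, hlAx⟩ := exists_QsLin_eq_sub_Dgrad_mem_Ax L (towerM L M k)
      (pow_ne_zero (k + 1) (hLne L)) A μ
    refine ⟨l, ?_, ?_⟩
    · show Qsk L M k (QsLin L (towerM L M k) l) = 0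
      rw [hlQ, hμQ]
    · refine (mem_axAll_succ_iff L M k _).mpr ⟨?_, ?_⟩
      · rw [gaugeR_eq_sub_Dgrad]
        exact hlAx
      · rw [Qlin_gaugeR_succ, hlQ]
        exact hμAx

/-- **UNIQUENESS of the hierarchical axial gauge**: `λ ∈ N(Q′_k)` as above is unique — by induction: the averages
`Q′λ` agree on level `k−1`, then §8. [cite: Balaban1984PropagatorsI, (1.23) p.21] -/
theorem hierGauge_unique : ∀ (k : ℕ) (A : Fld (towerM L M k)) (l l' : Scl (towerM L M k)),
    Qsk L M k l = 0 → gaugeR L M k A l ∈ AxAll L M k → Qsk L M k l' = 0 → gaugeR L M k A l' ∈ AxAll L M k → l = l'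
  | 0, _, l, l', hl, _, hl', _ => (show l = 0 from hl).trans (show l' = 0 from hl').symm
  | k + 1, A, l, l', hl, hAx, hl', hAx' => by
    obtain ⟨h1, h2⟩ := (mem_axAll_succ_iff L M k _).mp hAx
    obtain ⟨h1', h2'⟩ := (mem_axAll_succ_iff L M k _).mp hAx'
    rw [Qlin_gaugeR_succ] at h2 h2'
    have hμ : QsLin L (towerM L M k) l = QsLin L (towerM L M k) l' :=
      hierGauge_unique k (Qlin L (towerM L M k) A) _ _ hl h2 hl' h2'
    refine eq_of_QsLin_eq_of_Dgrad_sub_mem_Ax L (towerM L M k) (pow_ne_zero (k + 1) (hLne L)) hμ ?_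
    have h3 : Dgrad (towerM L M (k + 1)) ((L : ℝ) ^ (k + 1)) (l - l') =
        gaugeR L M (k + 1) A l' - gaugeR L M (k + 1) A l := by
      rw [gaugeR_eq_sub_Dgrad, gaugeR_eq_sub_Dgrad, map_sub]
      abel
    have h4 : Dgrad (towerM L M (k + 1)) ((L : ℝ) ^ (k + 1)) (l - l') ∈ Ax L (towerM L M k) := by
      rw [h3]
      exact (Ax L (towerM L M k)).sub_mem h1' h1
    exact h4

/-- existence and uniqueness together. [cite: Balaban1984PropagatorsI, (1.23) p.21] -/
theorem hierGauge_existsUnique (k : ℕ) (A : Fld (towerM L M k)) :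
    ∃! l : Scl (towerM L M k), Qsk L M k l = 0 ∧ gaugeR L M k A l ∈ AxAll L M k := by
  obtain ⟨l, hl, hAx⟩ := hierGauge_exists L M k A
  exact ⟨l, ⟨hl, hAx⟩, fun l' h' => hierGauge_unique L M k A l' l h'.1 h'.2 hl hAx⟩

end Tower

end

end Literature.MathematicalPhysics.QuantumFieldTheory.Balaban1983to89.B5HierGaugeTorus
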